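import Mathlib
import Literature.Computability.AlgebraicComplexity.StandardFamilies
import Literature.Barriers.PneNP.GCTOccurrenceObstructions
import Summits.ValiantsHypothesis.ValiantsHypothesis.Theses.ElementaryWordLength
import Summits.ValiantsHypothesis.ValiantsHypothesis.Cruxes.WordPerSuperQuartic.Ideator1Sketch
import Summits.ValiantsHypothesis.ValiantsHypothesis.Theorems.ElementaryWordLengthWordPerSuperQuarticOfBlockHardness

/-!
# Sketch — crux `WordPerSuperQuartic` (stmt-ValiantsHypothesis-6624), round 2, ideator 5

First lemmas of the crux idea card `powering-distortion` (file `idea-powering-distortion.md`).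
Statements only; `sorry` in proofs is deliberate (crux-ideate files signatures, not skeletons).

The card's transfer target is the MATRIX-POWERING family `Pow_k^d = tr (X^d)` (`X` the generic
`k × k` matrix; tree: `Literature.Barriers.PneNP.powTracePoly k d`), i.e. the iterated matrix
product `IMM_{k,d} = tr (X⁽⁰⁾ ⋯ X⁽ᵈ⁻¹⁾)` (tree: `immPoly k d ℂ`) with all layers IDENTIFIED.
Identifying layers is a relabelling of letters, free in the word model, so every lower bound for
`Pow_k^d` is one for `IMM_{k,d}`; the point of the card is that `d ↦ E₀₂(Pow_k^d)` is a sequence of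
root elements of ONE finitely generated group `E₃(𝔽[x_ij : i,j < k])`, so that the crux becomes a
DISTORTION-GROWTH statement in a fixed group (geometric group theory of `SL₃` over polynomial rings
without units), composed with the packing reduction of card `imm-packing-product-tax`
(`Sketch.wordPerSuperQuartic_of_imm`, imported from `Cruxes/WordPerSuperQuartic/Ideator1Sketch.lean`).
-/

set_option linter.dupNamespace false

namespace Summit.ValiantsHypothesis.ValiantsHypothesis.Cruxes.WordPerSuperQuartic.PoweringDistortion

open Literature.Computability.AlgebraicComplexity MvPolynomial
open Summit.ValiantsHypothesis.ValiantsHypothesis.Cruxes.WordPerSuperQuartic.Sketch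
  (Letter letterMat wordProd IsWordFor varLen IMMWordSuperCubic ImmSparseInPer)
open Literature.Barriers.PneNP (powTracePoly)

noncomputable section

/-! ## The layer-forgetting relabelling `IMM_{k,d} ↦ Pow_k^d` -/

/-- Forget the layer index of an `IMM` variable: `X⁽ᵗ⁾_{ij} ↦ X_{ij}`. -/
def forgetLayer (k d : ℕ) : Fin d × Fin k × Fin k → Fin k × Fin k := fun v => v.2

/-- **First lemma (a).** Identifying the layers of the iterated matrix product gives the matrix
power trace: `rename forgetLayer (tr (X⁽⁰⁾ ⋯ X⁽ᵈ⁻¹⁾)) = tr (X^d)`.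
(`rename` is a ring hom, commutes with `Matrix.trace` and products; the renamed layers are all
equal to the generic matrix `mvPolynomialX`, and the product of `d` copies is the `d`-th power.) -/
theorem rename_forgetLayer_immPoly (k d : ℕ) :
    rename (forgetLayer k d) (immPoly k d ℂ) = powTracePoly k d := by
  unfold immPoly powTracePoly immMatrix
  set f : MvPolynomial (Fin d × Fin k × Fin k) ℂ →+* MvPolynomial (Fin k × Fin k) ℂ :=
    (rename (forgetLayer k d)).toRingHom with hf
  have hlayer : ∀ t : Fin d,
      f.mapMatrix ((Matrix.mvPolynomialX (Fin k) (Fin k) ℂ).map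
        (rename fun ij : Fin k × Fin k => (t, ij))) = Matrix.mvPolynomialX (Fin k) (Fin k) ℂ := by
    intro t
    ext i j
    simp [hf, Matrix.mvPolynomialX_apply, rename_X, forgetLayer]
  have key : f (((List.finRange d).map fun t =>
      (Matrix.mvPolynomialX (Fin k) (Fin k) ℂ).map (rename fun ij : Fin k × Fin k => (t, ij))).prod).trace
      = ((Matrix.mvPolynomialX (Fin k) (Fin k) ℂ) ^ d).trace := by
    rw [AddMonoidHom.map_trace f]
    have hm : (((List.finRange d).map fun t =>
        (Matrix.mvPolynomialX (Fin k) (Fin k) ℂ).map (rename fun ij : Fin k × Fin k => (t, ij))).prod).map f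
        = f.mapMatrix (((List.finRange d).map fun t =>
        (Matrix.mvPolynomialX (Fin k) (Fin k) ℂ).map (rename fun ij : Fin k × Fin k => (t, ij))).prod) := by
      rfl
    rw [hm, map_list_prod, List.map_map]
    have hconst : (f.mapMatrix ∘ fun t : Fin d =>
        (Matrix.mvPolynomialX (Fin k) (Fin k) ℂ).map (rename fun ij : Fin k × Fin k => (t, ij)))
        = fun _ => Matrix.mvPolynomialX (Fin k) (Fin k) ℂ := by
      funext t
      exact hlayer t
    rw [hconst]
    rw [show ((List.finRange d).map fun _ => Matrix.mvPolynomialX (Fin k) (Fin k) ℂ)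
        = List.replicate d (Matrix.mvPolynomialX (Fin k) (Fin k) ℂ) by
      rw [List.map_const', List.length_finRange]]
    rw [List.prod_replicate]
  simpa [hf] using key

/-- Relabel the variable of a letter along `forgetLayer` (constant letters unchanged). -/
def relabel (k d : ℕ) (l : Letter (Fin d × Fin k × Fin k)) : Letter (Fin k × Fin k) :=
  (l.1, l.2.1, l.2.2.1, l.2.2.2.map (forgetLayer k d))

/-- **First lemma (b): words for `IMM` relabel to words for `Pow` of the same length and the same
number of variable letters** (`rename` applied entrywise to the word product is the product of the
relabelled letters; cf. the tree's `rename_wordProd` for the route's inline format). -/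
theorem isWordFor_pow_of_imm (k d : ℕ) (w : List (Letter (Fin d × Fin k × Fin k)))
    (hw : IsWordFor w (immPoly k d ℂ)) :
    IsWordFor (w.map (relabel k d)) (powTracePoly k d) ∧
      (w.map (relabel k d)).length = w.length ∧ varLen (w.map (relabel k d)) = varLen w := by
  refine ⟨⟨?_, ?_⟩, by simp, ?_⟩
  · intro l hl
    obtain ⟨l₀, h₀, rfl⟩ := List.mem_map.1 hl
    exact hw.1 l₀ h₀
  · have h := Summit.ValiantsHypothesis.ValiantsHypothesis.Theorems.WordPerSuperQuartic.rename_wordProd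
      (R := ℂ) (forgetLayer k d) w
    have hw2 := hw.2
    change (List.map letterMat w).prod = _ at hw2
    change (List.map letterMat (w.map (relabel k d))).prod = _
    have e1 : (List.map letterMat (w.map (relabel k d))) =
        ((w.map (fun l => (l.1, l.2.1, l.2.2.1, l.2.2.2.map (forgetLayer k d)))).map
          (fun l => Matrix.transvection l.1 l.2.1
            (C l.2.2.1 * l.2.2.2.elim 1 X : MvPolynomial (Fin k × Fin k) ℂ))) := rfl
    have e2 : (List.map letterMat w) = (w.map (fun l => Matrix.transvection l.1 l.2.1
        (C l.2.2.1 * l.2.2.2.elim 1 X))) := rfl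
    rw [e1, h, ← e2, hw2,
      Summit.ValiantsHypothesis.ValiantsHypothesis.Theorems.WordPerSuperQuartic.mapMatrix_transvection]
    congr 1
    simpa using rename_forgetLayer_immPoly k d
  · unfold varLen
    rw [List.filter_map, List.length_map]
    congr 1
    apply List.filter_congr
    intro l _
    simp [relabel, Option.isSome_map]

/-! ## C⁺ of the card: super-cubic word length for matrix powering of ONE fixed size `k` -/

/-- **C⁺ (transfer target) `PowWordSuperCubic k`.** For some `ε > 0` and all large `d`, every affine
elementary word for `E₀₂(tr X^d)`, `X` the generic `k × k` matrix, has at least `d^(3+ε)` VARIABLE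
letters.  A statement about the word length of the explicit sequence of root elements
`u_d = E₀₂(tr X^d)` in the single group `E₃(ℂ[x_ij : i, j < k])` with respect to the degree-`≤ 1`
elementary generators (constants free).  Known: `u_d` costs `≥ max(d, 2k²)` (degree; two reads) and
`≤ d^(log₂(3.46 k))` (binary powering with the `ShortWords` product words — the IMM upper bound);
so the statement is false for `k ≤ 2`, open in the windows `(3, 3.38]` (`k = 3`), `(3, 3.79]` (`k = 4`). -/
def PowWordSuperCubic (k : ℕ) : Prop :=
  ∃ ε : ℝ, 0 < ε ∧ ∃ d₀ : ℕ, ∀ d ≥ d₀, ∀ w : List (Letter (Fin k × Fin k)),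
    IsWordFor w (powTracePoly k d) → (d : ℝ) ^ (3 + ε) ≤ varLen w

/-- **C⁺ ⇒ C⁺(IMM)**: identifying layers is free, so super-cubic powering gives super-cubic `IMM`
(`IMMWordSuperCubic` of card `imm-packing-product-tax`, verbatim). -/
theorem immWordSuperCubic_of_pow (k : ℕ) (h : PowWordSuperCubic k) : IMMWordSuperCubic k := by
  obtain ⟨ε, hε, d₀, hd⟩ := h
  refine ⟨ε, hε, d₀, fun d hdd w hw => ?_⟩
  obtain ⟨hw', -, hlen⟩ := isWordFor_pow_of_imm k d w hw
  have := hd d hdd _ hw'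
  rw [hlen] at this
  exact this

/-- **Composition to the crux, by name** (through the imm card's checked-shape composition
`wordPerSuperQuartic_of_imm : 3 ≤ k → IMMWordSuperCubic k → ImmSparseInPer k c → WordPerSuperQuartic`,
itself a consequence of the packing identity and the cycle-cover embedding of `IMM` into `per`). -/
theorem wordPerSuperQuartic_of_pow (k c : ℕ) (hk : 3 ≤ k) (h₁ : PowWordSuperCubic k)
    (h₂ : ImmSparseInPer k c) :
    Summit.ValiantsHypothesis.ValiantsHypothesis.Theses.ElementaryWordLength.WordPerSuperQuartic :=
  Sketch.wordPerSuperQuartic_of_imm k c hk (immWordSuperCubic_of_pow k h₁) h₂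

/-! ## The engine the card proposes: the SQUARING TAX of a fixed group -/

/-- **Squaring tax `SquaringTax k c`**: doubling the exponent of the matrix power multiplies the
minimal number of variable letters by at least `c`, for all large `d`.  (For `k = 1` this is the
univariate monomial `t^d ↦ t^(2d)`: `c ≤ 3.2` by the dirty-commutator recursion, `c ≥ 2` trivially;
BFS values `ν(t²) = 4`, `ν(t³) = 8`, `ν(t⁴) > 10` over constants `{±1, ±2}` — the same as the
multilinear monomials.)  `c > 8` for ONE `k ≥ 3` gives `PowWordSuperCubic k` along the dyadic
exponents, which suffices for the crux (see `PowWordSuperCubicDyadic`). -/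
def SquaringTax (k : ℕ) (c : ℝ) : Prop :=
  ∃ d₀ : ℕ, ∀ d ≥ d₀, ∀ Λ : ℕ,
    (∀ w : List (Letter (Fin k × Fin k)), IsWordFor w (powTracePoly k d) → Λ ≤ varLen w) →
    ∀ w : List (Letter (Fin k × Fin k)), IsWordFor w (powTracePoly k (2 * d)) → c * Λ ≤ varLen w

/-- Dyadic form of C⁺ (enough for the crux: `per_N ⊂ per_n` for `N ≤ n` covers the gaps between
consecutive dyadic `d`, at the price `ε ↦ ε/2`). -/
def PowWordSuperCubicDyadic (k d₁ : ℕ) : Prop :=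
  ∃ ε : ℝ, 0 < ε ∧ ∃ j₀ : ℕ, ∀ j ≥ j₀, ∀ w : List (Letter (Fin k × Fin k)),
    IsWordFor w (powTracePoly k (2 ^ j * d₁)) → ((2 : ℝ) ^ j * d₁) ^ (3 + ε) ≤ varLen w

/-- **Squaring tax `> 8` ⇒ dyadic C⁺** (induction on `j`: `Λ_{j+1} ≥ c Λ_j`, `c = 8 · 2^{η}`). -/
theorem powWordSuperCubicDyadic_of_squaringTax (k d₁ : ℕ) (c : ℝ) (hc : 8 < c)
    (h : SquaringTax k c) (hd₁ : 1 ≤ d₁)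
    (h0 : ∀ w : List (Letter (Fin k × Fin k)), IsWordFor w (powTracePoly k d₁) → 1 ≤ varLen w) :
    PowWordSuperCubicDyadic k d₁ := by
  sorry

/-! ## The imported barrier for DEPTH-ONLY engines (free-group girth in the lower central series)

Malestein–Putman (2010): a non-trivial element of `γ_n(F₂)` has word length `≥ n`; Elkasapy–Thom
(2015): the shortest one has length `≼ n^{1.4412}`; a super-linear LOWER bound is open.  The map
`a ↦ E₀₁(x), b ↦ E₁₀(y)` sends `γ_n(F₂)` into the congruence subgroup of level `(x, y)^n`, and a word
of length `L` in `a^{±1}, b^{±1}` to an affine elementary word with `L` variable letters; hence any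
argument showing "an affine elementary word with `< d^{1+δ}` variable letters cannot be `≡ 1` modulo
the `d`-th power of the augmentation ideal unless it is `1`" would settle that open problem.  Engines
for product/powering taxes must therefore use the ROOT-ELEMENT form of the target, not only its depth. -/

/-- Congruence depth of a `3 × 3` polynomial matrix: `M ≡ 1` modulo monomials of degree `< n`
(every entry of `M - 1` has no monomial of total degree `< n`). -/
def CongruentOneMod {σ : Type} (M : Matrix (Fin 3) (Fin 3) (MvPolynomial σ ℂ)) (n : ℕ) : Prop :=
  ∀ i j, ∀ m : σ →₀ ℕ, m.degree < n → MvPolynomial.coeff m ((M - 1) i j) = 0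

/-- **Congruence girth is super-linear** (the depth-only statement): words of off-diagonal letters
whose product is `≡ 1 (mod deg ≥ d)` but `≠ 1` have `≥ d^(1+δ)` variable letters. OPEN; the card
records it as a barrier, not as a claim. -/
def CongruenceGirthSuperlinear : Prop :=
  ∃ δ : ℝ, 0 < δ ∧ ∃ d₀ : ℕ, ∀ d ≥ d₀, ∀ (σ : Type) (w : List (Letter σ)),
    (∀ l ∈ w, l.1 ≠ l.2.1) → CongruentOneMod (wordProd w) d → wordProd w ≠ 1 →
      (d : ℝ) ^ (1 + δ) ≤ varLen w

/-- **Girth of the free group `F₂` in its lower central series is super-linear** — the open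
problem of Malestein–Putman / Elkasapy–Thom (known: `≥ n`, `≼ n^{1.4412}`). -/
def LCSGirthSuperlinear : Prop :=
  ∃ δ : ℝ, 0 < δ ∧ ∃ n₀ : ℕ, ∀ n ≥ n₀, ∀ g : FreeGroup (Fin 2),
    g ∈ (⊤ : Subgroup (FreeGroup (Fin 2))).lowerCentralSeries n → g ≠ 1 → (n : ℝ) ^ (1 + δ) ≤ (FreeGroup.toWord g).length

/-- **The barrier implication**: a super-linear congruence girth for affine elementary words would
prove the open super-linear girth of `F₂` in its lower central series (via `a ↦ E₀₁(x)`, `b ↦ E₁₀(y)`,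
which is injective — a Sanov-type free subgroup — and maps `γ_n` into congruence depth `n`). -/
theorem lcsGirth_of_congruenceGirth : CongruenceGirthSuperlinear → LCSGirthSuperlinear := by
  sorry

end

end Summit.ValiantsHypothesis.ValiantsHypothesis.Cruxes.WordPerSuperQuartic.PoweringDistortion
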